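import Mathlib
import HarnessLib
import HarnessLib.Audit
import Summits.ValiantsHypothesis.ValiantsHypothesis.Theorems.SymmetryDialBent
import Summits.ValiantsHypothesis.ValiantsHypothesis.Theorems.SymmetryDialAffineOrbits

/-!
# SymmetryDial — third-order autocorrelation is degenerate on cubic bent functions; (I′) restricted to cubics

Route `SymmetryDial` (workshop `decomp-valiant`, lens 1, gen 8, Addendum B), item 23711 (P′ = `AffinePebblePairs`).
The first scalar that affine `C⁴` reads beyond `C³` on a Cayley structure `𝔄(M_f)` is the THIRD-ORDER
AUTOCORRELATION `T3 f u c = Σ_x (−1)^{f x + f(x+u) + f(x+c)}` (round 1 of the 4-pebble refinement; see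
`SymmetryDialAffinePebbleFour` for the proved filter).  Using the pointwise identity
`f x + f(x+u) + f(x+c) = f(x+u+c) + D_u D_c f (x)`:

* `T3_sq_of_degLeThree` (**Lemma 1 of Addendum B, now a theorem**): if `f` is bent and has algebraic degree
  `≤ 3` (all fourth derivatives vanish, `DegLeThree`), then `D_uD_cf` is affine, `T3 f u c = ± W_f(λ)` for
  the linear part `λ`, hence `(T3 f u c)² = 2^d` for ALL `u, c` — round 1 of `C⁴` carries only signs on cubic
  bent functions (the degenerate sub-habitat `𝒯_d ⊇ {deg ≤ 3}`).
* `CFourDecidesGLOnCubicBent` (`@[conjecture]`, the critic's g9 item (b)): (I′) restricted to cubic bent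
  functions, with `cubic_of_cFourDecidesGLOnBent : CFourDecidesGLOnBent → CFourDecidesGLOnCubicBent`.
  Evidence: d = 6 (all bents cubic; census (I′)-probe 0 breaches / 325 twists; the four EA classes pairwise
  `C⁴`-separated); cheapest falsifier: two GL-inequivalent cubic bent functions in 8 variables with equal
  round-≤2 profiles `(I_T, I_Δ, I_2, J_2)` of Addendum B (Maiorana–McFarland `x·π(y)+h(y)`, `π` a quadratic
  permutation of `𝔽₂⁴`, `h` cubic, is the natural family to table).
Instrument side only (LADDER-Valiant rung 0); nothing here bears on VP ≠ VNP.
-/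

namespace Summit.ValiantsHypothesis.ValiantsHypothesis.Theorems.SymmetryDialBentCubic

open Finset
open SymmetryDialAffinePebble (V pair AffinePebbleEquiv)
open SymmetryDialAffinePebbleThree (grpMat)
open SymmetryDialAffineOrbits (pair_add)
open SymmetryDialTranslationOrbits (pair_single)
open SymmetryDialWalsh (chi sgn walsh chi_add chi_sq sgn_mul_self add_eq_zero_iff)
open SymmetryDialBent (IsBent GLEquiv CFourDecidesGLOnBent)

variable {d : ℕ}

/-! ## §1 Boolean derivatives, degree ≤ 3, affine functions -/

/-- The Boolean derivative `D_a f (x) = f x + f (x + a)`. -/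
def derivB (a : V d) (f : V d → Bool) : V d → Bool := fun x => xor (f x) (f (x + a))

/-- Algebraic degree `≤ 3`: every fourth derivative vanishes identically. -/
def DegLeThree (f : V d → Bool) : Prop :=
  ∀ a b c e x, derivB a (derivB b (derivB c (derivB e f))) x = false

/-- Affine Boolean function: every second derivative vanishes identically. -/
def IsAffineB (h : V d → Bool) : Prop := ∀ a b x, derivB a (derivB b h) x = false

/-- Degree `≤ 3` iff all second derivatives are affine (definitional repackaging). -/
theorem degLeThree_iff (f : V d → Bool) : DegLeThree f ↔ ∀ c e, IsAffineB (derivB c (derivB e f)) :=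
  ⟨fun h c e a b x => h a b c e x, fun h a b c e x => h c e a b x⟩

/-- The sign `(−1)^b` of a Boolean. -/
def sgnB (b : Bool) : ℤ := if b = true then -1 else 1

/-- `sgn f x = (−1)^{f x}`. -/
theorem sgn_eq_sgnB (f : V d → Bool) (x : V d) : sgn f x = sgnB (f x) := rfl

/-- `(−1)^{a+b} = (−1)^a (−1)^b`. -/
theorem sgnB_xor (a b : Bool) : sgnB (xor a b) = sgnB a * sgnB b := by
  cases a <;> cases b <;> rfl

/-- `((−1)^a)² = 1`. -/
theorem sgnB_sq (a : Bool) : sgnB a ^ 2 = 1 := by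
  cases a <;> rfl

/-- An affine Boolean function is `h 0 +` a linear functional: `(−1)^{h x} = (−1)^{h 0} χ_λ(x)`. -/
theorem exists_chi_of_isAffineB (h : V d → Bool) (hh : IsAffineB h) :
    ∃ lam : V d, ∀ x, sgnB (h x) = sgnB (h 0) * chi lam x := by
  classical
  -- the linear part as an additive map to `Fin 2`
  let ell : V d → Fin 2 := fun x => if xor (h x) (h 0) = true then 1 else 0
  have hadd : ∀ x y, ell (x + y) = ell x + ell y := by
    intro x y
    have h2 := hh x y 0
    simp only [derivB, zero_add] at h2
    simp only [ell]
    revert h2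
    cases h 0 <;> cases h x <;> cases h y <;> cases h (x + y) <;> decide
  let L : V d →+ Fin 2 := { toFun := ell, map_zero' := by simp [ell], map_add' := hadd }
  let lam : V d := fun i => ell (Pi.single i 1)
  let P : V d →+ Fin 2 :=
    { toFun := fun x => pair lam x, map_zero' := by simp [pair], map_add' := pair_add lam }
  have hLP : L = P := by
    refine AddMonoidHom.functions_ext (Fin 2) L P fun i a => ?_
    fin_cases a
    · simp
    · show ell (Pi.single i 1) = pair lam (Pi.single i 1)
      rw [pair_single]
  refine ⟨lam, fun x => ?_⟩
  have hx : ell x = pair lam x := by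
    have := congrArg (fun φ : V d →+ Fin 2 => φ x) hLP
    simpa [L, P] using this
  unfold chi
  rw [← hx]
  have key : ∀ a b : Bool,
      sgnB a = sgnB b * (if (if xor a b = true then (1 : Fin 2) else 0) = 1 then -1 else 1) := by
    decide
  exact key (h x) (h 0)

/-! ## §2 The third-order autocorrelation and its degeneracy on cubic bent functions -/

/-- Third-order autocorrelation `T3 f u c = Σ_x (−1)^{f x + f(x+u) + f(x+c)}`. -/
def T3 (f : V d → Bool) (u c : V d) : ℤ := ∑ x, sgn f x * sgn f (x + u) * sgn f (x + c)

/-- Pointwise: `(−1)^{f x + f(x+u) + f(x+c)} = (−1)^{f(x+u+c)} · (−1)^{D_uD_cf(x)}`. -/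
theorem sgn_triple_eq (f : V d → Bool) (u c x : V d) :
    sgn f x * sgn f (x + u) * sgn f (x + c) =
      sgn f (x + u + c) * sgnB (derivB u (derivB c f) x) := by
  have hxuc : x + u + c = x + c + u := by abel
  simp only [sgn_eq_sgnB, derivB, hxuc]
  cases f x <;> cases f (x + u) <;> cases f (x + c) <;> cases f (x + c + u) <;> rfl

/-- `T3` rewritten through the second derivative. -/
theorem T3_eq_sum_deriv (f : V d → Bool) (u c : V d) :
    T3 f u c = ∑ x, sgn f (x + u + c) * sgnB (derivB u (derivB c f) x) := by
  unfold T3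
  exact Finset.sum_congr rfl fun x _ => sgn_triple_eq f u c x

/-- A translated Walsh sum: `Σ_x (−1)^{f(x+w)} χ_λ(x) = χ_λ(w) · W_f(λ)`. -/
theorem sum_sgn_translate_chi (f : V d → Bool) (lam w : V d) :
    ∑ x, sgn f (x + w) * chi lam x = chi lam w * walsh f lam := by
  have hww : w + w = 0 := (add_eq_zero_iff w w).2 rfl
  have h1 : ∑ x, sgn f (x + w) * chi lam x = ∑ x, sgn f x * chi lam (x + w) := by
    rw [← Equiv.sum_comp (Equiv.addRight w) (fun x => sgn f x * chi lam (x + w))]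
    refine Finset.sum_congr rfl fun x _ => ?_
    simp only [Equiv.coe_addRight]
    rw [add_assoc, hww, add_zero]
  rw [h1, walsh, Finset.mul_sum]
  refine Finset.sum_congr rfl fun x _ => ?_
  rw [chi_add]; ring

/-- **Lemma 1 (Addendum B).**  On a bent function of degree `≤ 3` the third-order autocorrelation is
degenerate: `(T3 f u c)² = 2^d` for all `u, c`. -/
theorem T3_sq_of_degLeThree (f : V d → Bool) (hf : IsBent f) (h3 : DegLeThree f) (u c : V d) :
    T3 f u c ^ 2 = 2 ^ d := by
  obtain ⟨lam, hlam⟩ := exists_chi_of_isAffineB _ ((degLeThree_iff f).1 h3 u c)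
  have hT : T3 f u c = sgnB (derivB u (derivB c f) 0) * chi lam (u + c) * walsh f lam := by
    rw [T3_eq_sum_deriv]
    have : ∑ x, sgn f (x + u + c) * sgnB (derivB u (derivB c f) x) =
        sgnB (derivB u (derivB c f) 0) * ∑ x, sgn f (x + (u + c)) * chi lam x := by
      rw [Finset.mul_sum]
      refine Finset.sum_congr rfl fun x _ => ?_
      rw [hlam x, add_assoc]; ring
    rw [this, sum_sgn_translate_chi, mul_assoc]
  rw [hT, mul_pow, mul_pow, sgnB_sq, chi_sq, one_mul, one_mul]
  exact hf.2 lam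

/-- Hence on cubic bent functions `|T3| = 2^{d/2}` takes one absolute value: `T3 f u c = ± T3 f u' c'`. -/
theorem T3_sq_eq_T3_sq (f : V d → Bool) (hf : IsBent f) (h3 : DegLeThree f) (u c u' c' : V d) :
    T3 f u c ^ 2 = T3 f u' c' ^ 2 := by
  rw [T3_sq_of_degLeThree f hf h3, T3_sq_of_degLeThree f hf h3]

/-! ## §3 (I′) restricted to cubic bent functions -/

/-- (I′)|cubic: «affine `C⁴` decides GL-equivalence on CUBIC bent Cayley structures».  Evidence: d = 6
(every bent function is cubic there; the four EA classes are pairwise `C⁴`-separated and 0/325 twists breach).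
Cheapest falsifier: d = 8, Maiorana–McFarland `x·π(y) + h(y)` with `π` a quadratic permutation of `𝔽₂⁴` and
`h` cubic — two GL-inequivalent members with equal round-≤2 profiles `(I_T, I_Δ, I_2, J_2)`. -/
@[conjecture]
def CFourDecidesGLOnCubicBent : Prop :=
  ∀ (d : ℕ) (f g : V d → Bool), IsBent f → IsBent g → DegLeThree f → DegLeThree g →
    AffinePebbleEquiv 4 d (grpMat f) (grpMat g) → GLEquiv f g

/-- The restriction is implied by the full conjecture (I′). -/
theorem cubic_of_cFourDecidesGLOnBent (h : CFourDecidesGLOnBent) : CFourDecidesGLOnCubicBent :=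
  fun d f g hf hg _ _ h4 => h d f g hf hg h4

end Summit.ValiantsHypothesis.ValiantsHypothesis.Theorems.SymmetryDialBentCubic
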